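import Literature.Analysis.UnboundedOperators.HeatKernelHeatEquation
import Literature.Analysis.UnboundedOperators.HeatKernelLpSmoothingProofs
import Mathlib.Analysis.Calculus.LineDeriv.IntegrationByParts
import Mathlib.Analysis.SpecialFunctions.ImproperIntegrals
import Mathlib.Analysis.SpecialFunctions.Integrals.Basic
import Mathlib.Analysis.SpecialFunctions.Integrability.Basic
import HarnessLib

/-!
# Calculus of the heat flow `e^{tΔ}` on `Lᵖ` data: derivatives, transposition, joint continuity, time FTC

Analysis/UnboundedOperators support file (heat kernel on a finite-dimensional real inner product
space `E`, `n = dim E`; the accepted caloric extension `Literature.heatExtension g t = G_t ⋆ g = e^{tΔ}g`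
of `HeatKernel.lean`, for data `g ∈ Lᵖ(E; F)` with values in a real Banach space `F`). It is the
bottom layer of the physical-space proof of Tao 2011, Prop. 9.1 (bounded total speed,
`FluidPDE/TaoBoundedTotalSpeedMild.lean`), which manipulates `e^{tΔ}` on `L¹`, `L²` and `L^∞` data
and never uses the Fourier transform; everything here is dimension-free and **proved**.

* **Kernel** (`section Kernel`): `∂ᵥG_t(z) = -(G_t(z)/(2t)) ⟪z, v⟫`
  (`fderiv_heatKernel_apply_eq_mul_inner`), evenness of `G_t`, oddness of `∇G_t`.
* **Derivative as a convolution** (`section DerivConv`): `∂ᵥ e^{tΔ}g = (∂ᵥG_t) ⋆ g` for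
  `g ∈ Lᵖ`, `1 ≤ p` (`fderiv_heatExtension_apply_eq_convolution`, from the accepted
  `fderiv_heatExtension_apply_eq_integral`), `∂ᵥG_t ∈ L¹ ∩ L^q` with
  `‖∂ᵥG_t‖₁ ≤ 2^{n/2} t^{-1/2} ‖v‖`, `‖∂ᵥG_t‖_∞ ≤ (4πt)^{-n/2} t^{-1/2} ‖v‖`, hence Young bounds
  `‖∂ᵥ e^{tΔ}g‖_p ≤ 2^{n/2} t^{-1/2} ‖v‖ ‖g‖_p` and the pointwise bound
  `|∂ᵥ e^{tΔ}g(x)| ≤ ‖∂ᵥG_t‖_{p'} ‖g‖_p` (`enorm_fderiv_heatExtension_apply_le`); smoothness of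
  `x ↦ ∂ᵥ e^{tΔ}g(x)`.
* **Derivatives fall on the data** (`section Commute`): for `g ∈ C¹` with `g ∈ Lᵖ`, `∂ᵥg ∈ L^q`,
  `∂ᵥ(e^{tΔ}g) = e^{tΔ}(∂ᵥg)` pointwise (`fderiv_heatExtension_apply_eq_heatExtension_fderiv`;
  integration by parts inside the convolution via Mathlib's
  `integral_smul_fderiv_eq_neg_fderiv_smul_of_integrable`; the tree's
  `fderiv_heatExtension_apply_of_hasCompactSupport` is the compactly supported case).
  Lemarié-Rieusset 2016, §6.2.
* **Transposition** (`section Transpose`): `∫ (K ⋆ f) g = ε ∫ f (K ⋆ g)` for a kernel with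
  `K(-z) = ε K(z)` (`ε = ±1`: `G_t` even, `∂ᵥG_t` odd), `K ∈ L¹`, `f ∈ Lᵖ`, `g ∈ L^q`, `p, q`
  conjugate (`integral_convolution_mul_eq`, Fubini–Tonelli).
* **Joint continuity** (`section JointContinuity`): `(σ, x) ↦ e^{σΔ}g(x)`, `∂ᵥe^{σΔ}g(x)`,
  `Δe^{σΔ}g(x)` are continuous on `(0, ∞) × E` for `g ∈ Lᵖ`
  (`continuousOn_uncurry_heatExtension_of_memLp`, `…_fderiv_…`, `…_laplacian_…`: dominated
  convergence with the Gaussian majorant `(2πσ₀)^{-n/2} e^{-‖z‖²/(8σ₀)}` of `G_σ(z)` for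
  `σ ∈ [σ₀/2, 2σ₀]`, `heatKernel_le_of_mem_Icc`).
* **Time FTC and decay** (`section TimeFTC`): `e^{bΔ}g(x) - e^{aΔ}g(x) = ∫ₐᵇ Δe^{σΔ}g(x) dσ`
  (`heatExtension_sub_eq_integral_laplacian`, from the accepted heat equation
  `hasDerivAt_heatExtension_time`), the decay `|e^{σΔ}g(x)| ≤ (4πσ)^{-n/(2p)} ‖g‖_p → 0` as `σ → ∞`
  for `p < ∞` (`enorm_heatExtension_le`, `tendsto_enorm_heatExtension_atTop`), and the
  representation bound `|e^{τΔ}g(x)| ≤ ∫_τ^∞ |Δe^{σΔ}g(x)| dσ`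
  (`enorm_heatExtension_le_lintegral_Ioi_laplacian`), the form in which the low-frequency part
  of a function is controlled by its heat-flow Laplacian (a physical-space substitute for
  Littlewood–Paley pieces `P_{<N}`).
* **Initial limit** (`section InitialLimit`): `e^{σΔ}g(x) → g(x)` as `σ → 0⁺` at every
  continuity point of `g ∈ Lᵖ` (`tendsto_heatExtension_nhdsGT_zero_of_continuousAt`; Evans
  2010, §2.3.1, Thm. 1 (iii), pointwise form).
* `section PowerIntegrals`: `∫_c^∞ τ^a dτ` (`a < -1`) and the shift `∫_{a}^∞ f(s - a) ds` in
  `lintegral` form.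

## Mathlib / tree search

Tree (all accepted and proved): `heatKernel`, `heatExtension`, `hasFDerivAt_heatKernel`,
`fderiv_heatExtension_apply_eq_integral`, `lintegral_enorm_fderiv_heatKernel_le`,
`norm_fderiv_heatKernel_le` (`HeatKernelGradient`), `contDiff_heatExtension_holds`,
`hasDerivAt_heatExtension_time`, `laplacian_heatExtension_eq_integral`,
`fderiv_heatExtension_apply_of_hasCompactSupport` (`HeatKernelHeatEquation`),
`eLpNorm_heatExtension_le_rpow_holds`, `integrable_temperate_mul_heatKernel_smul`
(`HeatKernelLpSmoothingProofs`). Not in the tree before this file (`lean search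
'heatExtension.*atTop|uncurry.*heatExtension|convolution_mul_eq|heatExtension_fderiv'`): the
commutation with derivatives of the data, the transposition identity, joint continuity in
`(σ, x)` for `Lᵖ` data, the time FTC / representation bound. (`BMOCarlesonDuality` has a
`BMOInv.tendsto_heatExtension_atTop` for bounded compactly supported mean-zero data — a different
statement.) Mathlib: `integral_smul_fderiv_eq_neg_fderiv_smul_of_integrable`,
`MeasureTheory.integral_integral_swap`, `intervalIntegral.integral_eq_sub_of_hasDerivAt`,
`integral_Ioi_rpow_of_lt`, `tendsto_integral_filter_of_dominated_convergence`.

## References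

* L. C. Evans, *Partial Differential Equations*, 2nd ed., AMS 2010, §2.3.1 (heat kernel,
  Thm. 1). Bib key `Evans2010`.
* P. G. Lemarié-Rieusset, *The Navier–Stokes Problem in the 21st Century*, CRC 2016, §6.2 (heat
  kernel calculus on Lebesgue data). Bib key `LemarieRieusset2016`.
* M.-H. Giga, Y. Giga, J. Saal, *Nonlinear Partial Differential Equations*, Birkhäuser 2010,
  §1.1.2–1.1.3 (`Lᵖ`–`L^q` and derivative estimates for `e^{tΔ}`). Bib key `GigaGigaSaal2010`.
* T. Tao, *Localisation and compactness properties of the Navier–Stokes global regularity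
  problem*, Anal. PDE 6 (2013) = arXiv:1108.1165, §9 (consumer). Bib key `Tao2011`.
-/

open MeasureTheory Filter Topology Set InnerProductSpace Metric
open scoped Real ENNReal NNReal Convolution Laplacian RealInnerProductSpace

noncomputable section

namespace Literature.Analysis.UnboundedOperators

section Kernel

variable {E : Type*} [NormedAddCommGroup E] [InnerProductSpace ℝ E]

/-- The directional derivative of the heat kernel: `∂ᵥ G_t(z) = -(G_t(z)/(2t)) ⟪z, v⟫`.
[folklore] -/
theorem fderiv_heatKernel_apply_eq_mul_inner (t : ℝ) (z v : E) :
    fderiv ℝ (heatKernel t) z v = -(heatKernel t z / (2 * t)) * ⟪z, v⟫ := by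
  rw [(hasFDerivAt_heatKernel t z).fderiv, FunLike.coe_smul, Pi.smul_apply,
    innerSL_apply_apply, smul_eq_mul]

/-- The heat kernel is even. [folklore] -/
theorem heatKernel_neg (t : ℝ) (z : E) : heatKernel t (-z) = heatKernel t z := by
  simp [heatKernel, norm_neg]

/-- The gradient of the heat kernel is odd: `∂ᵥ G_t(-z) = -∂ᵥ G_t(z)`. [folklore] -/
theorem fderiv_heatKernel_neg_apply (t : ℝ) (z v : E) :
    fderiv ℝ (heatKernel t) (-z) v = -fderiv ℝ (heatKernel t) z v := by
  rw [fderiv_heatKernel_apply_eq_mul_inner, fderiv_heatKernel_apply_eq_mul_inner, heatKernel_neg, inner_neg_left]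
  ring

/-- The directional derivative `z ↦ ∂ᵥ G_t(z)` is continuous. [folklore] -/
theorem continuous_fderiv_heatKernel_apply (t : ℝ) (v : E) :
    Continuous fun z => fderiv ℝ (heatKernel t) z v :=
  (continuous_fderiv_heatKernel t).clm_apply continuous_const

end Kernel

section DerivConv

variable {E : Type*} [NormedAddCommGroup E] [InnerProductSpace ℝ E] [FiniteDimensional ℝ E]
  [MeasurableSpace E] [BorelSpace E]
variable {F : Type*} [NormedAddCommGroup F] [NormedSpace ℝ F] [CompleteSpace F]

omit [CompleteSpace F] in
/-- **The derivative of the caloric extension is the convolution with the derivative of the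
kernel**: `∂ᵥ(e^{tΔ} f)(x) = ((∂ᵥ G_t) ⋆ f)(x)` for `f ∈ L^p`, `1 ≤ p ≤ ∞`, `0 < t`.
[folklore] -/
theorem fderiv_heatExtension_apply_eq_convolution {f : E → F} {p : ℝ≥0∞} (hf : MemLp f p volume)
    (hp : 1 ≤ p) {t : ℝ} (ht : 0 < t) (x v : E) :
    fderiv ℝ (heatExtension f t) x v =
      ((fun z => fderiv ℝ (heatKernel t) z v) ⋆[ContinuousLinearMap.lsmul ℝ ℝ, volume] f) x := by
  rw [fderiv_heatExtension_apply_eq_integral ht hf hp x v, convolution_lsmul_swap]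
  refine integral_congr_ae (Eventually.of_forall fun y => ?_)
  simp only [fderiv_heatKernel_apply_eq_mul_inner]
  congr 1
  ring

omit [CompleteSpace F] in
/-- The same identity at the level of functions. [folklore] -/
theorem fderiv_heatExtension_apply_eq_convolution' {f : E → F} {p : ℝ≥0∞} (hf : MemLp f p volume)
    (hp : 1 ≤ p) {t : ℝ} (ht : 0 < t) (v : E) :
    (fun x => fderiv ℝ (heatExtension f t) x v) =
      ((fun z => fderiv ℝ (heatKernel t) z v) ⋆[ContinuousLinearMap.lsmul ℝ ℝ, volume] f) :=
  funext fun x => fderiv_heatExtension_apply_eq_convolution hf hp ht x v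

/-- The directional derivative kernel `∂ᵥ G_t` is integrable (`0 < t`). [folklore] -/
theorem integrable_fderiv_heatKernel_apply {t : ℝ} (ht : 0 < t) (v : E) :
    Integrable (fun z : E => fderiv ℝ (heatKernel t) z v) := by
  have hb : 0 < 1 / (8 * t) := by positivity
  refine ((integrable_gaussian_of_pos (E := E) hb).const_mul
    ((4 * π * t) ^ (-(Module.finrank ℝ E : ℝ) / 2) * (Real.sqrt t)⁻¹ * ‖v‖)).mono'
    (continuous_fderiv_heatKernel_apply t v).aestronglyMeasurable
    (Eventually.of_forall fun z => ?_)
  calc ‖fderiv ℝ (heatKernel t) z v‖ ≤ ‖fderiv ℝ (heatKernel t) z‖ * ‖v‖ :=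
        ((fderiv ℝ (heatKernel t) z).le_opNorm v)
    _ ≤ (4 * π * t) ^ (-(Module.finrank ℝ E : ℝ) / 2) * (Real.sqrt t)⁻¹ *
          Real.exp (-(1 / (8 * t)) * ‖z‖ ^ 2) * ‖v‖ :=
        mul_le_mul_of_nonneg_right (norm_fderiv_heatKernel_le ht z) (norm_nonneg _)
    _ = _ := by ring

/-- The derivative kernel `∂ᵥ G_s` lies in every `L^q` (Gaussian domination). [folklore] -/
theorem memLp_fderiv_heatKernel_apply {s : ℝ} (hs : 0 < s) (v : E) (q : ℝ≥0∞) :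
    MemLp (fun z : E => fderiv ℝ (heatKernel s) z v) q volume := by
  have hb : 0 < 1 / (8 * s) := by positivity
  set c : ℝ := (4 * π * s) ^ (-(Module.finrank ℝ E : ℝ) / 2) * (Real.sqrt s)⁻¹ * ‖v‖ with hc
  refine ((memLp_gaussian_of_pos (E := E) hb q).const_mul c).of_le
    (continuous_fderiv_heatKernel_apply s v).aestronglyMeasurable
    (Eventually.of_forall fun z => ?_)
  calc ‖fderiv ℝ (heatKernel s) z v‖ ≤ ‖fderiv ℝ (heatKernel s) z‖ * ‖v‖ :=
        ((fderiv ℝ (heatKernel s) z).le_opNorm v)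
    _ ≤ (4 * π * s) ^ (-(Module.finrank ℝ E : ℝ) / 2) * (Real.sqrt s)⁻¹ *
          Real.exp (-(1 / (8 * s)) * ‖z‖ ^ 2) * ‖v‖ :=
        mul_le_mul_of_nonneg_right (norm_fderiv_heatKernel_le hs z) (norm_nonneg _)
    _ = c * Real.exp (-(1 / (8 * s)) * ‖z‖ ^ 2) := by rw [hc]; ring
    _ ≤ ‖c * Real.exp (-(1 / (8 * s)) * ‖z‖ ^ 2)‖ := Real.le_norm_self _

/-- `‖∂ᵥ G_t‖₁ ≤ 2^{n/2} t^{-1/2} ‖v‖`. [folklore] -/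
theorem lintegral_enorm_fderiv_heatKernel_apply_le {t : ℝ} (ht : 0 < t) (v : E) :
    ∫⁻ z, ‖fderiv ℝ (heatKernel (E := E) t) z v‖ₑ ≤
      ENNReal.ofReal ((2 : ℝ) ^ ((Module.finrank ℝ E : ℝ) / 2) * t ^ (-(1 / 2 : ℝ)) * ‖v‖) := by
  calc ∫⁻ z, ‖fderiv ℝ (heatKernel (E := E) t) z v‖ₑ
      ≤ ∫⁻ z, ‖fderiv ℝ (heatKernel (E := E) t) z‖ₑ * ‖v‖ₑ := by
        refine lintegral_mono fun z => ?_
        rw [← ofReal_norm, ← ofReal_norm, ← ofReal_norm, ← ENNReal.ofReal_mul (norm_nonneg _)]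
        exact ENNReal.ofReal_le_ofReal (((fderiv ℝ (heatKernel t) z).le_opNorm v))
    _ = (∫⁻ z, ‖fderiv ℝ (heatKernel (E := E) t) z‖ₑ) * ‖v‖ₑ := lintegral_mul_const _
        (continuous_fderiv_heatKernel t).measurable.enorm
    _ ≤ ENNReal.ofReal ((2 : ℝ) ^ ((Module.finrank ℝ E : ℝ) / 2) * t ^ (-(1 / 2 : ℝ))) *
          ENNReal.ofReal ‖v‖ := by
        rw [← ofReal_norm]
        exact mul_le_mul_left (lintegral_enorm_fderiv_heatKernel_le ht) _
    _ = _ := by rw [← ENNReal.ofReal_mul (by positivity)]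

/-- `‖∂ᵥ G_t‖_∞ ≤ (4πt)^{-n/2} t^{-1/2} ‖v‖`. [folklore] -/
theorem eLpNorm_top_fderiv_heatKernel_apply_le {t : ℝ} (ht : 0 < t) (v : E) :
    eLpNorm (fun z => fderiv ℝ (heatKernel (E := E) t) z v) ∞ volume ≤
      ENNReal.ofReal ((4 * π * t) ^ (-(Module.finrank ℝ E : ℝ) / 2) * (Real.sqrt t)⁻¹ * ‖v‖) := by
  rw [eLpNorm_exponent_top]
  refine eLpNormEssSup_le_of_ae_enorm_bound (Eventually.of_forall fun z => ?_)
  rw [← ofReal_norm]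
  refine ENNReal.ofReal_le_ofReal ?_
  calc ‖fderiv ℝ (heatKernel t) z v‖ ≤ ‖fderiv ℝ (heatKernel t) z‖ * ‖v‖ :=
        ((fderiv ℝ (heatKernel t) z).le_opNorm v)
    _ ≤ (4 * π * t) ^ (-(Module.finrank ℝ E : ℝ) / 2) * (Real.sqrt t)⁻¹ *
          Real.exp (-(1 / (8 * t)) * ‖z‖ ^ 2) * ‖v‖ :=
        mul_le_mul_of_nonneg_right (norm_fderiv_heatKernel_le ht z) (norm_nonneg _)
    _ ≤ (4 * π * t) ^ (-(Module.finrank ℝ E : ℝ) / 2) * (Real.sqrt t)⁻¹ * 1 * ‖v‖ := by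
        gcongr
        rw [Real.exp_le_one_iff]
        have : 0 ≤ 1 / (8 * t) * ‖z‖ ^ 2 := by positivity
        linarith
    _ = _ := by ring

omit [CompleteSpace F] in
/-- **Young `L¹ × Lᵖ → Lᵖ` for the derivative**: `‖∂ᵥ e^{tΔ} f‖_p ≤ 2^{n/2} t^{-1/2} ‖v‖ ‖f‖_p`,
`1 ≤ p ≤ ∞`. [folklore] -/
theorem eLpNorm_fderiv_heatExtension_apply_le {f : E → F} {p : ℝ≥0∞} (hf : MemLp f p volume)
    (hp : 1 ≤ p) {t : ℝ} (ht : 0 < t) (v : E) :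
    eLpNorm (fun x => fderiv ℝ (heatExtension f t) x v) p volume ≤
      ENNReal.ofReal ((2 : ℝ) ^ ((Module.finrank ℝ E : ℝ) / 2) * t ^ (-(1 / 2 : ℝ)) * ‖v‖) *
        eLpNorm f p volume := by
  rw [fderiv_heatExtension_apply_eq_convolution' hf hp ht v]
  exact (eLpNorm_convolution_le_lintegral_enorm_mul
    (continuous_fderiv_heatKernel_apply t v).aestronglyMeasurable hf.1 hp).trans
    (mul_le_mul_left (lintegral_enorm_fderiv_heatKernel_apply_le ht v) _)

omit [CompleteSpace F] in
/-- The directional derivative of the caloric extension of an `Lᵖ` function is in `Lᵖ`,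
`1 ≤ p ≤ ∞`. [folklore] -/
theorem memLp_fderiv_heatExtension_apply {f : E → F} {p : ℝ≥0∞} (hf : MemLp f p volume)
    (hp : 1 ≤ p) {t : ℝ} (ht : 0 < t) (v : E) :
    MemLp (fun x => fderiv ℝ (heatExtension f t) x v) p volume := by
  rw [fderiv_heatExtension_apply_eq_convolution' hf hp ht v]
  exact memLp_convolution_lsmul (integrable_fderiv_heatKernel_apply ht v) hf hp

omit [CompleteSpace F] in
/-- **Young `L^{p'} × Lᵖ → L^∞` for the derivative**: pointwise,
`‖∂ᵥ e^{tΔ} f (x)‖ ≤ ‖∂ᵥ G_t‖_{q} ‖f‖_p` for conjugate exponents. [folklore] -/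
theorem enorm_fderiv_heatExtension_apply_le {f : E → F} {p : ℝ≥0∞} (hf : MemLp f p volume)
    (hp : 1 ≤ p) {t : ℝ} (ht : 0 < t) (x v : E) (q : ℝ≥0∞) [q.HolderConjugate p] :
    ‖fderiv ℝ (heatExtension f t) x v‖ₑ ≤
      eLpNorm (fun z => fderiv ℝ (heatKernel (E := E) t) z v) q volume * eLpNorm f p volume := by
  rw [fderiv_heatExtension_apply_eq_convolution hf hp ht x v]
  exact enorm_convolution_lsmul_le_eLpNorm_mul_eLpNorm
    (continuous_fderiv_heatKernel_apply t v).aestronglyMeasurable hf.1 q p x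

/-- The caloric extension of an `Lᵖ` function is smooth, hence so is its directional
derivative. [folklore] -/
theorem contDiff_fderiv_heatExtension_apply {f : E → F} {p : ℝ≥0∞} (hf : MemLp f p volume)
    (hp : 1 ≤ p) {t : ℝ} (ht : 0 < t) (v : E) {n : ℕ∞} :
    ContDiff ℝ n (fun x => fderiv ℝ (heatExtension f t) x v) := by
  have h := contDiff_heatExtension_holds hf hp ht
  have h' : ContDiff ℝ (⊤ : ℕ∞) (fderiv ℝ (heatExtension f t)) :=
    (contDiff_infty_iff_fderiv.1 h).2
  exact (h'.clm_apply contDiff_const).of_le (by exact_mod_cast le_top)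

end DerivConv

section Commute

variable {E : Type*} [NormedAddCommGroup E] [InnerProductSpace ℝ E] [FiniteDimensional ℝ E]
  [MeasurableSpace E] [BorelSpace E]
variable {F : Type*} [NormedAddCommGroup F] [NormedSpace ℝ F] [CompleteSpace F]

/-! ### Derivatives fall on `C¹` data with `Lᵖ` derivative -/

omit [CompleteSpace F] in
/-- **Derivatives fall on the data.** For `g ∈ C¹(E; F)` with `g ∈ Lᵖ` and `∂ᵥ g ∈ L^q`
(`1 ≤ p, q ≤ ∞`) and `0 < t`: `∂ᵥ (e^{tΔ} g)(x) = e^{tΔ} (∂ᵥ g)(x)` for every `x` (integration by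
parts inside the convolution, no boundary terms on the whole space). Lemarié-Rieusset 2016, §6.2
(`W_{νt} ∗ ∂^α u₀ = ∂^α (W_{νt} ∗ u₀)`). [folklore] -/
theorem fderiv_heatExtension_apply_eq_heatExtension_fderiv {g : E → F} (hg : ContDiff ℝ 1 g)
    {p q : ℝ≥0∞} (hgp : MemLp g p volume) (hp : 1 ≤ p) {v : E}
    (hgq : MemLp (fun x => fderiv ℝ g x v) q volume) (hq : 1 ≤ q) {t : ℝ} (ht : 0 < t) (x : E) :
    fderiv ℝ (heatExtension g t) x v = heatExtension (fun z => fderiv ℝ g z v) t x := by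
  rw [heatExtension_eq_integral_sub, fderiv_heatExtension_apply_eq_integral ht hgp hp x v]
  -- the reflected kernel `φ y = G_t(x - y)` and its derivative
  set φ : E → ℝ := fun y => heatKernel t (x - y) with hφ
  have hφd : ∀ y, HasFDerivAt φ ((fderiv ℝ (heatKernel t) (x - y)).comp (-ContinuousLinearMap.id ℝ E)) y := by
    intro y
    have h1 : HasFDerivAt (fun y : E => x - y) (-ContinuousLinearMap.id ℝ E) y :=
      (hasFDerivAt_id y).const_sub x
    have h2 := (hasFDerivAt_heatKernel t (x - y)).comp y h1
    rw [← (hasFDerivAt_heatKernel t (x - y)).fderiv] at h2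
    exact h2
  have hφ' : ∀ y, fderiv ℝ φ y v = -fderiv ℝ (heatKernel t) (x - y) v := fun y => by
    rw [(hφd y).fderiv]
    simp
  have hgd : ∀ y, DifferentiableAt ℝ g y := fun y => (hg.differentiable one_ne_zero y)
  -- integrability of the three products
  have hP : (fun z : E => -(1 / (2 * t)) * ⟪z, v⟫).HasTemperateGrowth := by
    have := ((-(1 / (2 * t))) • innerSL ℝ v : E →L[ℝ] ℝ).hasTemperateGrowth
    convert this using 1
    funext z
    simp [real_inner_comm]
  have i1 : Integrable (fun y => fderiv ℝ φ y v • g y) := by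
    have := (integrable_temperate_mul_heatKernel_smul ht hgp hp hP x).neg
    refine this.congr (Eventually.of_forall fun y => ?_)
    simp only [hφ', fderiv_heatKernel_apply_eq_mul_inner, Pi.neg_apply, neg_smul]
    congr 1
    ring_nf
  have i2 : Integrable (fun y => φ y • fderiv ℝ g y v) := by
    simpa using integrable_temperate_mul_heatKernel_smul ht hgq hq
      (Function.HasTemperateGrowth.const 1) x
  have i3 : Integrable (fun y => φ y • g y) := by
    simpa using integrable_temperate_mul_heatKernel_smul ht hgp hp
      (Function.HasTemperateGrowth.const 1) x
  have key := integral_smul_fderiv_eq_neg_fderiv_smul_of_integrable (μ := volume) i1 i2 i3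
    (fun y _ => (hφd y).differentiableAt) (fun y _ => hgd y)
  rw [key, ← integral_neg]
  refine integral_congr_ae (Eventually.of_forall fun y => ?_)
  simp only [hφ', neg_smul, neg_neg, fderiv_heatKernel_apply_eq_mul_inner]
  congr 1
  ring

end Commute

section Transpose

variable {E : Type*} [NormedAddCommGroup E] [InnerProductSpace ℝ E] [FiniteDimensional ℝ E]
  [MeasurableSpace E] [BorelSpace E]

/-- Integrability on `E × E` of `(x, y) ↦ K(x - y) g(y) h(x)` for `K ∈ L¹ ∩ L^q`, `g ∈ Lᵖ`,
`h ∈ L^q`, `1/p + 1/q = 1` (Young and Hölder). [folklore] -/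
theorem integrable_kernel_mul_mul {K : E → ℝ} (hK1 : Integrable K) {p q : ℝ≥0∞}
    [hpq : p.HolderConjugate q] (hKq : MemLp K q volume) {g h : E → ℝ} (hg : MemLp g p volume)
    (hh : MemLp h q volume) :
    Integrable (fun z : E × E => K (z.1 - z.2) * g z.2 * h z.1) (volume.prod volume) := by
  have hmeas : AEStronglyMeasurable (fun z : E × E => K (z.1 - z.2) * g z.2 * h z.1)
      (volume.prod volume) := by
    refine ((hK1.aestronglyMeasurable.comp_quasiMeasurePreserving
      (quasiMeasurePreserving_sub_of_right_invariant volume volume)).mul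
      (hg.1.comp_snd)).mul hh.1.comp_fst
  rw [integrable_prod_iff hmeas]
  constructor
  · refine Eventually.of_forall fun x => ?_
    have hKx : MemLp (fun y => K (x - y)) q volume :=
      hKq.comp_measurePreserving (Measure.measurePreserving_sub_left volume x)
    have h1 : MemLp (fun y => K (x - y) * g y) 1 volume := hg.mul' hKx
    have h2 : Integrable (fun y => K (x - y) * g y) := memLp_one_iff_integrable.1 h1
    simpa [mul_assoc, mul_comm, mul_left_comm] using h2.mul_const (h x)
  · -- `x ↦ (|K| ⋆ |g|)(x) |h x|` is integrable
    set Y : E → ℝ := (fun z => ‖K z‖) ⋆[ContinuousLinearMap.lsmul ℝ ℝ, volume] fun y => ‖g y‖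
      with hYdef
    have hY : MemLp Y p volume := memLp_convolution_lsmul hK1.norm hg.norm hpq.one_le
    have hprod : Integrable (fun x => ‖h x‖ * Y x) := memLp_one_iff_integrable.1 (hY.mul' hh.norm)
    have hpt : ∀ x, ‖h x‖ * Y x = ∫ y, ‖K (x - y) * g y * h x‖ := fun x => by
      rw [hYdef, convolution_lsmul_swap, ← integral_const_mul]
      refine integral_congr_ae (Eventually.of_forall fun y => ?_)
      simp only [smul_eq_mul, norm_mul]
      ring
    refine hprod.congr (Eventually.of_forall fun x => ?_)
    dsimp only
    exact hpt x

/-- **Transposition of a convolution against an even/odd kernel.** If `K(-z) = ε K(z)` and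
`(x, y) ↦ K(x - y) g(y) h(x)` is integrable on `E × E`, then
`∫ (K ⋆ g) h = ε ∫ g (K ⋆ h)` (Fubini). [folklore] -/
theorem integral_convolution_mul_eq {K : E → ℝ} {ε : ℝ} (hKε : ∀ z, K (-z) = ε * K z)
    {g h : E → ℝ}
    (hint : Integrable (fun z : E × E => K (z.1 - z.2) * g z.2 * h z.1) (volume.prod volume)) :
    ∫ x, (K ⋆[ContinuousLinearMap.lsmul ℝ ℝ, volume] g) x * h x =
      ε * ∫ y, g y * (K ⋆[ContinuousLinearMap.lsmul ℝ ℝ, volume] h) y := by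
  have h1 : ∀ x, (K ⋆[ContinuousLinearMap.lsmul ℝ ℝ, volume] g) x * h x =
      ∫ y, K (x - y) * g y * h x := fun x => by
    rw [convolution_lsmul_swap, ← integral_mul_const]
    simp only [smul_eq_mul]
  have h2 : ∀ y, g y * (K ⋆[ContinuousLinearMap.lsmul ℝ ℝ, volume] h) y =
      ∫ x, g y * (K (y - x) * h x) := fun y => by
    rw [convolution_lsmul_swap, ← integral_const_mul]
    simp only [smul_eq_mul]
  simp_rw [h1, h2]
  rw [integral_integral_swap hint, ← integral_const_mul]
  refine integral_congr_ae (Eventually.of_forall fun y => ?_)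
  dsimp only
  rw [← integral_const_mul]
  refine integral_congr_ae (Eventually.of_forall fun x => ?_)
  dsimp only
  have : K (x - y) = ε * K (y - x) := by rw [← hKε, neg_sub]
  rw [this]
  ring

end Transpose

section JointContinuity

variable {E : Type*} [NormedAddCommGroup E] [InnerProductSpace ℝ E] [FiniteDimensional ℝ E]
  [MeasurableSpace E] [BorelSpace E]
variable {F : Type*} [NormedAddCommGroup F] [NormedSpace ℝ F] [CompleteSpace F]

omit [CompleteSpace F] in
/-- **Joint continuity of Gaussian-dominated parametric convolutions.** Let `L : ℝ → E → ℝ` be a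
kernel family, jointly continuous on `(0, ∞) × E`, with local-in-time Gaussian domination: for
every `σ₀ > 0` there are `C` and `b > 0` with `|L σ z| ≤ C exp (-b‖z‖²)` for `σ ∈ [σ₀/2, 2σ₀]`.
Then for `g ∈ Lᵖ`, `1 ≤ p ≤ ∞`, the map `(σ, x) ↦ ∫ L σ (x - y) • g y dy` is continuous on
`(0, ∞) × E` (dominated convergence). [folklore] -/
theorem continuousOn_integral_kernel_smul {L : ℝ → E → ℝ}
    (hL : ContinuousOn (Function.uncurry L) (Ioi 0 ×ˢ univ))
    (hdom : ∀ σ₀ : ℝ, 0 < σ₀ → ∃ C b : ℝ, 0 < b ∧ ∀ σ ∈ Icc (σ₀ / 2) (2 * σ₀), ∀ z,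
      |L σ z| ≤ C * Real.exp (-b * ‖z‖ ^ 2))
    {g : E → F} {p : ℝ≥0∞} (hg : MemLp g p volume) (hp : 1 ≤ p) :
    ContinuousOn (fun q : ℝ × E => ∫ y, L q.1 (q.2 - y) • g y) (Ioi 0 ×ˢ univ) := by
  rintro ⟨σ₀, x₀⟩ ⟨hσ₀', -⟩
  have hσ₀ : 0 < σ₀ := hσ₀'
  refine ContinuousAt.continuousWithinAt ?_
  obtain ⟨C, b, hb, hCb⟩ := hdom σ₀ hσ₀
  have hC : 0 ≤ C := by
    have := hCb σ₀ ⟨by linarith, by linarith⟩ 0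
    have h0 : (0 : ℝ) ≤ |L σ₀ 0| := abs_nonneg _
    simp only [norm_zero, ne_eq, OfNat.ofNat_ne_zero, not_false_eq_true, zero_pow, mul_zero,
      Real.exp_zero, mul_one] at this
    linarith
  -- the neighbourhood of `(σ₀, x₀)` on which the domination is uniform
  have hU : Ioo (σ₀ / 2) (2 * σ₀) ×ˢ ball x₀ 1 ∈ 𝓝 (σ₀, x₀) :=
    prod_mem_nhds (Ioo_mem_nhds (by linarith) (by linarith)) (ball_mem_nhds x₀ one_pos)
  have hmeasL : ∀ σ, 0 < σ → Continuous (L σ) := fun σ hσ =>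
    (hL.comp_continuous (Continuous.prodMk_right σ) fun z => ⟨hσ, mem_univ _⟩ :)
  refine continuousAt_of_dominated (bound := fun y => C * Real.exp b *
    (Real.exp (-(b / 2) * ‖x₀ - y‖ ^ 2) * ‖g y‖)) ?_ ?_ ?_ ?_
  · -- measurability near `(σ₀, x₀)`
    filter_upwards [hU] with q hq
    have hq0 : 0 < q.1 := by linarith [hq.1.1]
    exact (((hmeasL q.1 hq0).comp (continuous_const.sub continuous_id)).aestronglyMeasurable).smul
      hg.1
  · -- domination near `(σ₀, x₀)`
    filter_upwards [hU] with q hq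
    refine Eventually.of_forall fun y => ?_
    obtain ⟨⟨hq1, hq2⟩, hqx⟩ := hq
    rw [norm_smul, Real.norm_eq_abs]
    have h1 : |L q.1 (q.2 - y)| ≤ C * Real.exp (-b * ‖q.2 - y‖ ^ 2) :=
      hCb q.1 ⟨hq1.le, hq2.le⟩ _
    have hx' : ‖q.2 - x₀‖ < 1 := by rwa [mem_ball, dist_eq_norm] at hqx
    have hsq : ‖x₀ - y‖ ^ 2 ≤ 2 * ‖q.2 - y‖ ^ 2 + 2 := by
      have htri : ‖x₀ - y‖ ≤ ‖q.2 - y‖ + ‖q.2 - x₀‖ := by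
        calc ‖x₀ - y‖ = ‖(q.2 - y) - (q.2 - x₀)‖ := by rw [sub_sub_sub_cancel_left]
          _ ≤ ‖q.2 - y‖ + ‖q.2 - x₀‖ := norm_sub_le _ _
      have e1 : ‖x₀ - y‖ ^ 2 ≤ (‖q.2 - y‖ + ‖q.2 - x₀‖) ^ 2 :=
        pow_le_pow_left₀ (norm_nonneg _) htri 2
      have e2 : ‖q.2 - x₀‖ ^ 2 ≤ 1 := by
        have := norm_nonneg (q.2 - x₀)
        nlinarith
      nlinarith [sq_nonneg (‖q.2 - y‖ - ‖q.2 - x₀‖)]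
    have h2 : Real.exp (-b * ‖q.2 - y‖ ^ 2) ≤ Real.exp b * Real.exp (-(b / 2) * ‖x₀ - y‖ ^ 2) := by
      rw [← Real.exp_add]
      exact Real.exp_le_exp.2 (by nlinarith)
    calc |L q.1 (q.2 - y)| * ‖g y‖ ≤ C * Real.exp (-b * ‖q.2 - y‖ ^ 2) * ‖g y‖ :=
          mul_le_mul_of_nonneg_right h1 (norm_nonneg _)
      _ ≤ C * (Real.exp b * Real.exp (-(b / 2) * ‖x₀ - y‖ ^ 2)) * ‖g y‖ := by gcongr
      _ = _ := by ring
  · -- integrability of the bound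
    have hb2 : 0 < b / 2 := by positivity
    have := integrable_gaussian_smul_of_memLp hb2 x₀ hg.norm hp
    simp only [smul_eq_mul] at this
    exact this.const_mul _
  · -- continuity of the integrand in the parameter
    refine Eventually.of_forall fun y => ?_
    have hc : ContinuousAt (fun q : ℝ × E => L q.1 (q.2 - y)) (σ₀, x₀) := by
      have h1 : ContinuousAt (fun q : ℝ × E => (q.1, q.2 - y)) (σ₀, x₀) :=
        (continuousAt_fst.prodMk (continuousAt_snd.sub continuousAt_const))
      have h2 : ContinuousAt (Function.uncurry L) (σ₀, x₀ - y) :=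
        hL.continuousAt ((isOpen_Ioi.prod isOpen_univ).mem_nhds ⟨hσ₀, mem_univ _⟩)
      exact ContinuousAt.comp_of_eq h2 h1 rfl
    exact hc.smul continuousAt_const

omit [FiniteDimensional ℝ E] [MeasurableSpace E] [BorelSpace E] in
/-- The heat kernel family `(σ, z) ↦ G_σ(z)` satisfies the hypotheses of
`continuousOn_integral_kernel_smul`: joint continuity. [folklore] -/
theorem continuousOn_uncurry_heatKernel' :
    ContinuousOn (Function.uncurry (heatKernel (E := E))) (Ioi 0 ×ˢ univ) :=
  (contDiffOn_uncurry_heatKernel (m := 0)).continuousOn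

omit [FiniteDimensional ℝ E] [MeasurableSpace E] [BorelSpace E] in
/-- Local Gaussian domination of the heat kernel: for `σ ∈ [σ₀/2, 2σ₀]`,
`G_σ(z) ≤ (2πσ₀)^{-n/2} exp (-‖z‖²/(8σ₀))`. [folklore] -/
theorem heatKernel_le_of_mem_Icc {σ₀ : ℝ} (hσ₀ : 0 < σ₀) {σ : ℝ} (hσ : σ ∈ Icc (σ₀ / 2) (2 * σ₀))
    (z : E) :
    heatKernel σ z ≤ (4 * π * (σ₀ / 2)) ^ (-(Module.finrank ℝ E : ℝ) / 2) *
      Real.exp (-(1 / (8 * σ₀)) * ‖z‖ ^ 2) := by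
  have hσpos : 0 < σ := by linarith [hσ.1]
  rw [heatKernel_eq]
  refine mul_le_mul ?_ ?_ (by positivity) (by positivity)
  · exact Real.rpow_le_rpow_of_nonpos (by positivity) (by nlinarith [hσ.1, Real.pi_pos])
      (by rw [neg_div]; exact neg_nonpos.2 (by positivity))
  · refine Real.exp_le_exp.2 (mul_le_mul_of_nonneg_right (neg_le_neg ?_) (by positivity))
    exact one_div_le_one_div_of_le (by positivity) (by linarith [hσ.2])

omit [CompleteSpace F] in
/-- **Joint continuity of `(σ, x) ↦ e^{σΔ} g (x)`** on `(0, ∞) × E` for `g ∈ Lᵖ`,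
`1 ≤ p ≤ ∞`. Evans, *PDE*, §2.3.1, Thm. 1 (i). [folklore] -/
theorem continuousOn_uncurry_heatExtension_of_memLp {g : E → F} {p : ℝ≥0∞} (hg : MemLp g p volume)
    (hp : 1 ≤ p) :
    ContinuousOn (fun q : ℝ × E => heatExtension g q.1 q.2) (Ioi 0 ×ˢ univ) := by
  have h := continuousOn_integral_kernel_smul (L := heatKernel) continuousOn_uncurry_heatKernel'
    (fun σ₀ hσ₀ => ⟨(4 * π * (σ₀ / 2)) ^ (-(Module.finrank ℝ E : ℝ) / 2), 1 / (8 * σ₀),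
      by positivity, fun σ hσ z => by
        rw [abs_of_nonneg (heatKernel_pos (by linarith [hσ.1]) z).le]
        exact heatKernel_le_of_mem_Icc hσ₀ hσ z⟩) hg hp
  refine h.congr fun q _ => ?_
  exact heatExtension_eq_integral_sub g q.1 q.2

omit [CompleteSpace F] in
/-- **Joint continuity of `(σ, x) ↦ ∂ᵥ e^{σΔ} g (x)`** on `(0, ∞) × E` for `g ∈ Lᵖ`,
`1 ≤ p ≤ ∞`. [folklore] -/
theorem continuousOn_uncurry_fderiv_heatExtension_of_memLp {g : E → F} {p : ℝ≥0∞}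
    (hg : MemLp g p volume) (hp : 1 ≤ p) (v : E) :
    ContinuousOn (fun q : ℝ × E => fderiv ℝ (heatExtension g q.1) q.2 v) (Ioi 0 ×ˢ univ) := by
  have hL : ContinuousOn (Function.uncurry fun σ z => fderiv ℝ (heatKernel (E := E) σ) z v)
      (Ioi 0 ×ˢ univ) := by
    have heq : (Function.uncurry fun σ z => fderiv ℝ (heatKernel (E := E) σ) z v) =
        fun q : ℝ × E => -(Function.uncurry heatKernel q / (2 * q.1)) * ⟪q.2, v⟫ := by
      funext q
      simp [Function.uncurry, fderiv_heatKernel_apply_eq_mul_inner]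
    rw [heq]
    refine ((continuousOn_uncurry_heatKernel'.div (continuousOn_const.mul continuousOn_fst)
      fun q hq => ?_).neg).mul (continuousOn_snd.inner continuousOn_const)
    have : (0 : ℝ) < q.1 := hq.1
    exact mul_ne_zero two_ne_zero this.ne'
  have hdom : ∀ σ₀ : ℝ, 0 < σ₀ → ∃ C b : ℝ, 0 < b ∧ ∀ σ ∈ Icc (σ₀ / 2) (2 * σ₀), ∀ z : E,
      |fderiv ℝ (heatKernel σ) z v| ≤ C * Real.exp (-b * ‖z‖ ^ 2) := by
    intro σ₀ hσ₀
    refine ⟨(4 * π * (σ₀ / 2)) ^ (-(Module.finrank ℝ E : ℝ) / 2) * (Real.sqrt (σ₀ / 2))⁻¹ * ‖v‖,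
      1 / (16 * σ₀), by positivity, fun σ hσ z => ?_⟩
    have hσ' : 0 < σ := by linarith [hσ.1]
    rw [← Real.norm_eq_abs]
    calc ‖fderiv ℝ (heatKernel σ) z v‖ ≤ ‖fderiv ℝ (heatKernel σ) z‖ * ‖v‖ :=
          ((fderiv ℝ (heatKernel σ) z).le_opNorm v)
      _ ≤ (4 * π * σ) ^ (-(Module.finrank ℝ E : ℝ) / 2) * (Real.sqrt σ)⁻¹ *
            Real.exp (-(1 / (8 * σ)) * ‖z‖ ^ 2) * ‖v‖ :=
          mul_le_mul_of_nonneg_right (norm_fderiv_heatKernel_le hσ' z) (norm_nonneg _)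
      _ ≤ (4 * π * (σ₀ / 2)) ^ (-(Module.finrank ℝ E : ℝ) / 2) * (Real.sqrt (σ₀ / 2))⁻¹ *
            Real.exp (-(1 / (16 * σ₀)) * ‖z‖ ^ 2) * ‖v‖ := by
          refine mul_le_mul_of_nonneg_right (mul_le_mul (mul_le_mul ?_ ?_ (by positivity)
            (by positivity)) ?_ (by positivity) (by positivity)) (norm_nonneg v)
          · exact Real.rpow_le_rpow_of_nonpos (by positivity) (by nlinarith [hσ.1, Real.pi_pos])
              (by rw [neg_div]; exact neg_nonpos.2 (by positivity))
          · exact inv_anti₀ (Real.sqrt_pos.2 (by positivity)) (Real.sqrt_le_sqrt hσ.1)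
          · refine Real.exp_le_exp.2 (mul_le_mul_of_nonneg_right (neg_le_neg ?_) (by positivity))
            exact one_div_le_one_div_of_le (by positivity) (by linarith [hσ.2])
      _ = _ := by ring
  have h := continuousOn_integral_kernel_smul hL hdom hg hp
  refine h.congr fun q hq => ?_
  have hq1 : (0 : ℝ) < q.1 := hq.1
  rw [fderiv_heatExtension_apply_eq_convolution hg hp hq1, convolution_lsmul_swap]

/-- **Joint continuity of `(σ, x) ↦ Δ e^{σΔ} g (x)`** on `(0, ∞) × E` for `g ∈ Lᵖ`,
`1 ≤ p ≤ ∞`. [folklore] -/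
theorem continuousOn_uncurry_laplacian_heatExtension_of_memLp {g : E → F} {p : ℝ≥0∞}
    (hg : MemLp g p volume) (hp : 1 ≤ p) :
    ContinuousOn (fun q : ℝ × E => (Δ (heatExtension g q.1)) q.2) (Ioi 0 ×ˢ univ) := by
  set L : ℝ → E → ℝ := fun σ z =>
    (‖z‖ ^ 2 / (4 * σ ^ 2) - (Module.finrank ℝ E : ℝ) / (2 * σ)) * heatKernel σ z with hLdef
  have hL : ContinuousOn (Function.uncurry L) (Ioi 0 ×ˢ univ) := by
    have heq : Function.uncurry L = fun q : ℝ × E =>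
        (‖q.2‖ ^ 2 / (4 * q.1 ^ 2) - (Module.finrank ℝ E : ℝ) / (2 * q.1)) *
          Function.uncurry heatKernel q := by
      funext q; simp [hLdef, Function.uncurry]
    rw [heq]
    refine ContinuousOn.mul ?_ continuousOn_uncurry_heatKernel'
    refine ((continuousOn_snd.norm.pow 2).div (continuousOn_const.mul (continuousOn_fst.pow 2))
      fun q hq => ?_).sub (continuousOn_const.div (continuousOn_const.mul continuousOn_fst)
      fun q hq => ?_)
    · have : (0 : ℝ) < q.1 := hq.1
      exact mul_ne_zero (by norm_num) (pow_ne_zero 2 this.ne')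
    · have : (0 : ℝ) < q.1 := hq.1
      exact mul_ne_zero two_ne_zero this.ne'
  have hdom : ∀ σ₀ : ℝ, 0 < σ₀ → ∃ C b : ℝ, 0 < b ∧ ∀ σ ∈ Icc (σ₀ / 2) (2 * σ₀), ∀ z : E,
      |L σ z| ≤ C * Real.exp (-b * ‖z‖ ^ 2) := by
    intro σ₀ hσ₀
    obtain ⟨C, -, hC⟩ := exists_abs_timeWeight_mul_heatKernel_le (E := E) hσ₀
    refine ⟨C, 1 / (16 * σ₀), by positivity, fun σ hσ z => ?_⟩
    have hσ' : 0 < σ := by linarith [hσ.1]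
    rw [hLdef]
    dsimp only
    rw [abs_mul, abs_of_nonneg (heatKernel_pos hσ' z).le]
    exact hC σ hσ z
  have h := continuousOn_integral_kernel_smul hL hdom hg hp
  refine h.congr fun q hq => ?_
  have hq1 : (0 : ℝ) < q.1 := hq.1
  rw [laplacian_heatExtension_eq_integral hq1 hg hp]

end JointContinuity

section TimeFTC

variable {E : Type*} [NormedAddCommGroup E] [InnerProductSpace ℝ E] [FiniteDimensional ℝ E]
  [MeasurableSpace E] [BorelSpace E]
variable {F : Type*} [NormedAddCommGroup F] [NormedSpace ℝ F] [CompleteSpace F]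

/-- Continuity in time, at a fixed point, of `σ ↦ Δ e^{σΔ} g (x)` on `(0, ∞)`. [folklore] -/
theorem continuousOn_laplacian_heatExtension_time {g : E → F} {p : ℝ≥0∞} (hg : MemLp g p volume)
    (hp : 1 ≤ p) (x : E) :
    ContinuousOn (fun σ : ℝ => (Δ (heatExtension g σ)) x) (Ioi 0) :=
  (continuousOn_uncurry_laplacian_heatExtension_of_memLp hg hp).comp
    (f := fun σ : ℝ => ((σ, x) : ℝ × E)) (Continuous.prodMk_left x).continuousOn
    (fun _ hσ => mk_mem_prod hσ (mem_univ x))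

omit [CompleteSpace F] in
/-- Continuity in time, at a fixed point, of `σ ↦ e^{σΔ} g (x)` on `(0, ∞)`. [folklore] -/
theorem continuousOn_heatExtension_time {g : E → F} {p : ℝ≥0∞} (hg : MemLp g p volume)
    (hp : 1 ≤ p) (x : E) :
    ContinuousOn (fun σ : ℝ => heatExtension g σ x) (Ioi 0) :=
  (continuousOn_uncurry_heatExtension_of_memLp hg hp).comp
    (f := fun σ : ℝ => ((σ, x) : ℝ × E)) (Continuous.prodMk_left x).continuousOn
    (fun _ hσ => mk_mem_prod hσ (mem_univ x))

omit [CompleteSpace F] in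
/-- Continuity in time, at a fixed point, of `σ ↦ ∂ᵥ e^{σΔ} g (x)` on `(0, ∞)`. [folklore] -/
theorem continuousOn_fderiv_heatExtension_time {g : E → F} {p : ℝ≥0∞} (hg : MemLp g p volume)
    (hp : 1 ≤ p) (x v : E) :
    ContinuousOn (fun σ : ℝ => fderiv ℝ (heatExtension g σ) x v) (Ioi 0) :=
  (continuousOn_uncurry_fderiv_heatExtension_of_memLp hg hp v).comp
    (f := fun σ : ℝ => ((σ, x) : ℝ × E)) (Continuous.prodMk_left x).continuousOn
    (fun _ hσ => mk_mem_prod hσ (mem_univ x))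

/-- **The heat equation integrated in time**: for `g ∈ Lᵖ`, `1 ≤ p ≤ ∞`, `0 < a ≤ b`,
`e^{bΔ} g (x) - e^{aΔ} g (x) = ∫ₐᵇ Δ e^{σΔ} g (x) dσ`. Evans, *PDE*, §2.3.1, Thm. 1 (ii).
[folklore] -/
theorem heatExtension_sub_eq_integral_laplacian {g : E → F} {p : ℝ≥0∞} (hg : MemLp g p volume)
    (hp : 1 ≤ p) {a b : ℝ} (ha : 0 < a) (hab : a ≤ b) (x : E) :
    heatExtension g b x - heatExtension g a x = ∫ σ in a..b, (Δ (heatExtension g σ)) x := by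
  rw [intervalIntegral.integral_eq_sub_of_hasDerivAt]
  · intro σ hσ
    rw [uIcc_of_le hab] at hσ
    exact hasDerivAt_heatExtension_time (by linarith [hσ.1]) hg hp x
  · refine ContinuousOn.intervalIntegrable ?_
    rw [uIcc_of_le hab]
    exact (continuousOn_laplacian_heatExtension_time hg hp x).mono fun σ hσ =>
      lt_of_lt_of_le ha hσ.1

omit [CompleteSpace F] in
/-- **Pointwise decay of the caloric extension**: `‖e^{σΔ} g (x)‖ ≤ (4πσ)^{-n/(2p)} ‖g‖_p`
for `g ∈ Lᵖ`, `1 ≤ p ≤ ∞`, `0 < σ` (Hölder). Giga–Giga–Saal, *Nonlinear PDEs*, §1.1.3.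
[folklore] -/
theorem enorm_heatExtension_le {g : E → F} {p : ℝ≥0∞} (hg : MemLp g p volume) (hp : 1 ≤ p)
    {σ : ℝ} (hσ : 0 < σ) (x : E) :
    ‖heatExtension g σ x‖ₑ ≤
      ENNReal.ofReal ((4 * π * σ) ^ (-(Module.finrank ℝ E : ℝ) / 2)) ^ p⁻¹.toReal *
        eLpNorm g p volume := by
  haveI : p.HolderConjugate p.conjExponent := .conjExponent hp
  have hK : AEStronglyMeasurable (heatKernel (E := E) σ) volume :=
    (continuous_heatKernel σ).aestronglyMeasurable
  calc ‖heatExtension g σ x‖ₑ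
      ≤ eLpNorm (heatKernel σ) p.conjExponent volume * eLpNorm g p volume :=
        enorm_convolution_lsmul_le_eLpNorm_mul_eLpNorm hK hg.1 p.conjExponent p x
    _ ≤ _ := by
        gcongr
        rw [← ENNReal.HolderConjugate.one_sub_inv p.conjExponent p]
        exact eLpNorm_heatKernel_le hσ (ENNReal.HolderConjugate.one_le p.conjExponent p)

omit [CompleteSpace F] in
/-- The caloric extension of `g ∈ Lᵖ`, `1 ≤ p < ∞`, tends to zero pointwise as `σ → ∞`
(on a space of positive dimension). [folklore] -/
theorem tendsto_enorm_heatExtension_atTop {g : E → F} {p : ℝ≥0∞} (hg : MemLp g p volume) (hp : 1 ≤ p)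
    (hp' : p ≠ ∞) (hn : 0 < Module.finrank ℝ E) (x : E) :
    Tendsto (fun σ : ℝ => (‖heatExtension g σ x‖ₑ : ℝ≥0∞)) atTop (𝓝 0) := by
  set n : ℝ := (Module.finrank ℝ E : ℝ) with hn'
  have hn0 : 0 < n := by rw [hn']; exact_mod_cast hn
  have hp0 : p ≠ 0 := (zero_lt_one.trans_le hp).ne'
  have hr : 0 < p⁻¹.toReal := by
    rw [ENNReal.toReal_inv]
    exact inv_pos.2 (ENNReal.toReal_pos hp0 hp')
  -- the bound `σ ↦ ((4πσ)^{-n/2})^{1/p} ‖g‖_p` tends to zero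
  have hbound : Tendsto (fun σ : ℝ => ENNReal.ofReal ((4 * π * σ) ^ (-n / 2)) ^ p⁻¹.toReal *
      eLpNorm g p volume) atTop (𝓝 0) := by
    have h1 : Tendsto (fun σ : ℝ => (4 * π * σ) ^ (-n / 2)) atTop (𝓝 0) := by
      have := (tendsto_rpow_neg_atTop (y := n / 2) (by positivity)).comp
        (tendsto_id.const_mul_atTop (by positivity : (0 : ℝ) < 4 * π))
      refine this.congr fun σ => ?_
      simp [neg_div]
    have h1' : Tendsto (fun σ : ℝ => ENNReal.ofReal ((4 * π * σ) ^ (-n / 2))) atTop (𝓝 0) := by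
      simpa using ENNReal.tendsto_ofReal h1
    have h2 : Tendsto (fun σ : ℝ => ENNReal.ofReal ((4 * π * σ) ^ (-n / 2)) ^ p⁻¹.toReal) atTop
        (𝓝 0) := by
      have := ((ENNReal.continuous_rpow_const (y := p⁻¹.toReal)).tendsto 0).comp h1'
      rw [ENNReal.zero_rpow_of_pos hr] at this
      exact this
    have := ENNReal.Tendsto.mul_const h2 (Or.inr hg.eLpNorm_ne_top)
    simpa using this
  refine tendsto_of_tendsto_of_tendsto_of_le_of_le' tendsto_const_nhds hbound
    (Eventually.of_forall fun σ => bot_le) ?_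
  filter_upwards [eventually_gt_atTop 0] with σ hσ
  exact enorm_heatExtension_le hg hp hσ x

/-- **Representation from infinity**: for `g ∈ Lᵖ`, `1 ≤ p < ∞`, `0 < τ` (positive dimension),
`‖e^{τΔ} g (x)‖ ≤ ∫_τ^∞ ‖Δ e^{σΔ} g (x)‖ dσ` — from `e^{τΔ}g = e^{SΔ}g - ∫_τ^S ∂_σ e^{σΔ} g dσ`
and `e^{SΔ} g (x) → 0`. [folklore] -/
theorem enorm_heatExtension_le_lintegral_Ioi_laplacian {g : E → F} {p : ℝ≥0∞}
    (hg : MemLp g p volume) (hp : 1 ≤ p) (hp' : p ≠ ∞) (hn : 0 < Module.finrank ℝ E) {τ : ℝ}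
    (hτ : 0 < τ) (x : E) :
    ‖heatExtension g τ x‖ₑ ≤ ∫⁻ σ in Ioi τ, ‖(Δ (heatExtension g σ)) x‖ₑ := by
  set I : ℝ≥0∞ := ∫⁻ σ in Ioi τ, ‖(Δ (heatExtension g σ)) x‖ₑ with hI
  have hS : ∀ S, τ ≤ S → ‖heatExtension g τ x‖ₑ ≤ ‖heatExtension g S x‖ₑ + I := by
    intro S hS
    have hsub := heatExtension_sub_eq_integral_laplacian hg hp hτ hS x
    have heq : heatExtension g τ x =
        heatExtension g S x - ∫ σ in τ..S, (Δ (heatExtension g σ)) x := by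
      rw [← hsub]; abel
    calc ‖heatExtension g τ x‖ₑ
        = ‖heatExtension g S x - ∫ σ in τ..S, (Δ (heatExtension g σ)) x‖ₑ := by rw [← heq]
      _ ≤ ‖heatExtension g S x‖ₑ + ‖∫ σ in τ..S, (Δ (heatExtension g σ)) x‖ₑ := enorm_sub_le
      _ ≤ ‖heatExtension g S x‖ₑ + I := by
          gcongr
          rw [intervalIntegral.integral_of_le hS]
          refine (enorm_integral_le_lintegral_enorm _).trans ?_
          exact lintegral_mono_set Ioc_subset_Ioi_self
  have hlim : Tendsto (fun S : ℝ => ‖heatExtension g S x‖ₑ + I) atTop (𝓝 (0 + I)) :=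
    (tendsto_enorm_heatExtension_atTop hg hp hp' hn x).add tendsto_const_nhds
  rw [zero_add] at hlim
  exact ge_of_tendsto hlim (Filter.eventually_atTop.2 ⟨τ, hS⟩)

end TimeFTC

section InitialLimit

variable {E : Type*} [NormedAddCommGroup E] [InnerProductSpace ℝ E] [FiniteDimensional ℝ E]
  [MeasurableSpace E] [BorelSpace E]
variable {F : Type*} [NormedAddCommGroup F] [NormedSpace ℝ F] [CompleteSpace F]

omit [FiniteDimensional ℝ E] [MeasurableSpace E] [BorelSpace E] in
/-- Off-diagonal smallness of the heat kernel: for `0 < σ ≤ 1` and `δ ≤ ‖z‖`,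
`G_σ(z) ≤ (4πσ)^{-n/2} e^{-δ²/(8σ)} · e^{-‖z‖²/8}`. [folklore] -/
theorem heatKernel_le_of_le_norm {σ δ : ℝ} (hσ : 0 < σ) (hσ1 : σ ≤ 1) (hδ : 0 ≤ δ) {z : E}
    (hz : δ ≤ ‖z‖) :
    heatKernel σ z ≤ (4 * π * σ) ^ (-(Module.finrank ℝ E : ℝ) / 2) *
      Real.exp (-(δ ^ 2 / (8 * σ))) * Real.exp (-(1 / 8) * ‖z‖ ^ 2) := by
  rw [heatKernel_eq]
  suffices key : Real.exp (-(1 / (4 * σ)) * ‖z‖ ^ 2) ≤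
      Real.exp (-(δ ^ 2 / (8 * σ))) * Real.exp (-(1 / 8) * ‖z‖ ^ 2) by
    calc (4 * π * σ) ^ (-(Module.finrank ℝ E : ℝ) / 2) * Real.exp (-(1 / (4 * σ)) * ‖z‖ ^ 2)
        ≤ (4 * π * σ) ^ (-(Module.finrank ℝ E : ℝ) / 2) *
          (Real.exp (-(δ ^ 2 / (8 * σ))) * Real.exp (-(1 / 8) * ‖z‖ ^ 2)) :=
          mul_le_mul_of_nonneg_left key (by positivity)
      _ = _ := by ring
  rw [← Real.exp_add]
  refine Real.exp_le_exp.2 ?_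
  have h1 : δ ^ 2 ≤ ‖z‖ ^ 2 := pow_le_pow_left₀ hδ hz 2
  have h2 : (1 / 8) * ‖z‖ ^ 2 ≤ (1 / (8 * σ)) * ‖z‖ ^ 2 := by
    refine mul_le_mul_of_nonneg_right ?_ (by positivity)
    rw [one_div_le_one_div (by norm_num) (by positivity)]
    linarith
  have h3 : δ ^ 2 / (8 * σ) ≤ (1 / (8 * σ)) * ‖z‖ ^ 2 := by
    rw [div_eq_mul_one_div, mul_comm]
    exact mul_le_mul_of_nonneg_left h1 (by positivity)
  have : -(1 / (4 * σ)) * ‖z‖ ^ 2 = -((1 / (8 * σ)) * ‖z‖ ^ 2) - (1 / (8 * σ)) * ‖z‖ ^ 2 := by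
    ring
  rw [this]
  linarith

omit [FiniteDimensional ℝ E] [MeasurableSpace E] [BorelSpace E] in
/-- The off-diagonal factor `(4πσ)^{-n/2} e^{-δ²/(8σ)}` tends to zero as `σ → 0⁺` (`δ > 0`).
[folklore] -/
theorem tendsto_offDiagonal_factor {δ : ℝ} (hδ : 0 < δ) :
    Tendsto (fun σ : ℝ => (4 * π * σ) ^ (-(Module.finrank ℝ E : ℝ) / 2) *
      Real.exp (-(δ ^ 2 / (8 * σ)))) (𝓝[>] 0) (𝓝 0) := by
  set n : ℝ := (Module.finrank ℝ E : ℝ) with hn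
  have hb : 0 < δ ^ 2 / 8 := by positivity
  have h1 := (tendsto_rpow_mul_exp_neg_mul_atTop_nhds_zero (n / 2) (δ ^ 2 / 8) hb).comp
    tendsto_inv_nhdsGT_zero
  have h2 : Tendsto (fun σ : ℝ => (4 * π) ^ (-n / 2) * ((σ⁻¹) ^ (n / 2) *
      Real.exp (-(δ ^ 2 / 8) * σ⁻¹))) (𝓝[>] 0) (𝓝 ((4 * π) ^ (-n / 2) * 0)) :=
    h1.const_mul _
  rw [mul_zero] at h2
  refine h2.congr' ?_
  filter_upwards [self_mem_nhdsWithin] with σ hσ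
  rw [mem_Ioi] at hσ
  rw [Real.mul_rpow (by positivity) hσ.le, Real.inv_rpow hσ.le, ← Real.rpow_neg hσ.le, neg_div]
  have : -(δ ^ 2 / 8) * σ⁻¹ = -(δ ^ 2 / (8 * σ)) := by
    field_simp
  rw [this]
  ring

/-- **Pointwise convergence at the initial time for continuous data**: if `g ∈ Lᵖ`,
`1 ≤ p ≤ ∞`, is continuous at `x`, then `e^{σΔ} g (x) → g (x)` as `σ → 0⁺`.
Evans, *PDE*, §2.3.1, Thm. 1 (iii). [folklore] -/
theorem tendsto_heatExtension_nhdsGT_zero_of_continuousAt {g : E → F} {p : ℝ≥0∞}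
    (hg : MemLp g p volume) (hp : 1 ≤ p) {x : E} (hgx : ContinuousAt g x) :
    Tendsto (fun σ : ℝ => heatExtension g σ x) (𝓝[>] 0) (𝓝 (g x)) := by
  set n : ℝ := (Module.finrank ℝ E : ℝ) with hn
  rw [Metric.tendsto_nhds]
  intro ε hε
  -- continuity radius
  obtain ⟨δ, hδ, hδε⟩ : ∃ δ > 0, ∀ y, ‖y - x‖ < δ → ‖g y - g x‖ < ε / 2 := by
    have := Metric.continuousAt_iff.1 hgx (ε / 2) (by positivity)
    obtain ⟨δ, hδ, h⟩ := this
    exact ⟨δ, hδ, fun y hy => by rw [← dist_eq_norm]; exact h (by rwa [dist_eq_norm])⟩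
  -- the integrable majorant of the tail and its mass `M`
  set w : E → ℝ := fun y => Real.exp (-(1 / 8) * ‖x - y‖ ^ 2) * (‖g y‖ + ‖g x‖) with hw
  have hwi : Integrable w := by
    have h8 : (0 : ℝ) < 1 / 8 := by norm_num
    have i1 := integrable_gaussian_smul_of_memLp h8 x hg.norm hp
    have i2 : Integrable (fun y : E => Real.exp (-(1 / 8) * ‖x - y‖ ^ 2) * ‖g x‖) :=
      ((integrable_gaussian_of_pos (E := E) h8).comp_sub_left x).mul_const _
    simp only [smul_eq_mul] at i1
    refine (i1.add i2).congr (Eventually.of_forall fun y => ?_)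
    simp only [hw, Pi.add_apply, mul_add]
  have hw0 : ∀ y, 0 ≤ w y := fun y => by rw [hw]; positivity
  set M : ℝ := ∫ y, w y with hM
  have hM0 : 0 ≤ M := integral_nonneg hw0
  -- eventually the off-diagonal factor is small and `σ ≤ 1`
  have hρ := tendsto_offDiagonal_factor (E := E) hδ
  have hsmall : ∀ᶠ σ in 𝓝[>] (0 : ℝ), (4 * π * σ) ^ (-n / 2) * Real.exp (-(δ ^ 2 / (8 * σ))) *
      M < ε / 2 := by
    rcases hM0.eq_or_lt with hM' | hM'
    · refine Eventually.of_forall fun σ => ?_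
      rw [← hM', mul_zero]; exact half_pos hε
    · have := (Metric.tendsto_nhds.1 hρ) (ε / 2 / M) (by positivity)
      filter_upwards [this, self_mem_nhdsWithin] with σ hσ hσpos
      rw [mem_Ioi] at hσpos
      rw [dist_zero_right, Real.norm_of_nonneg (by positivity)] at hσ
      rwa [lt_div_iff₀ hM'] at hσ
  have hle1 : ∀ᶠ σ in 𝓝[>] (0 : ℝ), σ ≤ 1 :=
    mem_of_superset (Ioo_mem_nhdsGT zero_lt_one) fun σ hσ => hσ.2.le
  filter_upwards [hsmall, hle1, self_mem_nhdsWithin] with σ hσM hσ1 hσ0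
  rw [mem_Ioi] at hσ0
  set ρ : ℝ := (4 * π * σ) ^ (-n / 2) * Real.exp (-(δ ^ 2 / (8 * σ))) with hρdef
  have hρ0 : 0 ≤ ρ := by positivity
  -- the representation `e^{σΔ}g x - g x = ∫ G_σ(x - y) (g y - g x) dy`
  have hint1 : Integrable (fun y => heatKernel σ (x - y) • g y) := by
    simpa using integrable_temperate_mul_heatKernel_smul hσ0 hg hp
      (Function.HasTemperateGrowth.const 1) x
  have hint2 : Integrable (fun y => heatKernel σ (x - y) • g x) :=
    ((integrable_heatKernel_holds hσ0).comp_sub_left x).smul_const _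
  have hrepr : heatExtension g σ x - g x = ∫ y, heatKernel σ (x - y) • (g y - g x) := by
    have h1 : ∫ y, heatKernel σ (x - y) • g x = g x := by
      rw [integral_smul_const, integral_sub_left_eq_self (heatKernel σ) volume x,
        integral_heatKernel_eq_one_holds hσ0, one_smul]
    rw [heatExtension_eq_integral_sub]
    simp_rw [smul_sub]
    rw [integral_sub hint1 hint2, h1]
  rw [dist_eq_norm, hrepr]
  -- pointwise majorant
  have hmaj : ∀ y, ‖heatKernel σ (x - y) • (g y - g x)‖ ≤
      (ε / 2) * heatKernel σ (x - y) + ρ * w y := by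
    intro y
    rw [norm_smul, Real.norm_of_nonneg (heatKernel_pos hσ0 _).le]
    by_cases hy : ‖y - x‖ < δ
    · have := hδε y hy
      have h0 : 0 ≤ ρ * w y := mul_nonneg hρ0 (hw0 y)
      nlinarith [heatKernel_pos hσ0 (x - y)]
    · rw [not_lt] at hy
      have hy' : δ ≤ ‖x - y‖ := by rwa [norm_sub_rev]
      have hK := heatKernel_le_of_le_norm hσ0 hσ1 hδ.le hy'
      have htri : ‖g y - g x‖ ≤ ‖g y‖ + ‖g x‖ := norm_sub_le _ _
      have h0 : 0 ≤ (ε / 2) * heatKernel σ (x - y) :=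
        mul_nonneg (by positivity) (heatKernel_pos hσ0 _).le
      calc heatKernel σ (x - y) * ‖g y - g x‖
          ≤ (ρ * Real.exp (-(1 / 8) * ‖x - y‖ ^ 2)) * (‖g y‖ + ‖g x‖) :=
            mul_le_mul hK htri (norm_nonneg _) (by positivity)
        _ = ρ * w y := by rw [hw]; ring
        _ ≤ _ := by linarith
  have hint3 : Integrable (fun y => (ε / 2) * heatKernel σ (x - y) + ρ * w y) :=
    (((integrable_heatKernel_holds hσ0).comp_sub_left x).const_mul _).add (hwi.const_mul _)
  calc ‖∫ y, heatKernel σ (x - y) • (g y - g x)‖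
      ≤ ∫ y, ‖heatKernel σ (x - y) • (g y - g x)‖ := norm_integral_le_integral_norm _
    _ ≤ ∫ y, (ε / 2) * heatKernel σ (x - y) + ρ * w y :=
        integral_mono_of_nonneg (Eventually.of_forall fun y => norm_nonneg _) hint3
          (Eventually.of_forall hmaj)
    _ = ε / 2 + ρ * M := by
        rw [integral_add (((integrable_heatKernel_holds hσ0).comp_sub_left x).const_mul _)
          (hwi.const_mul _), integral_const_mul, integral_const_mul,
          integral_sub_left_eq_self (heatKernel σ) volume x, integral_heatKernel_eq_one_holds hσ0,
          mul_one]
    _ < ε / 2 + ε / 2 := by linarith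
    _ = ε := by ring

end InitialLimit

section PowerIntegrals

/-! ### Power integrals in `lintegral` form -/

/-- `∫⁻_{(c,∞)} τ^a dτ = -c^{a+1}/(a+1)` for `a < -1`, `0 < c`. [folklore] -/
theorem lintegral_Ioi_rpow {a : ℝ} (ha : a < -1) {c : ℝ} (hc : 0 < c) :
    ∫⁻ τ in Ioi c, ENNReal.ofReal (τ ^ a) = ENNReal.ofReal (-c ^ (a + 1) / (a + 1)) := by
  rw [← ofReal_integral_eq_lintegral_ofReal (integrableOn_Ioi_rpow_of_lt ha hc),
    integral_Ioi_rpow_of_lt ha hc]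
  refine (ae_restrict_iff' measurableSet_Ioi).2 (Eventually.of_forall fun τ hτ => ?_)
  exact Real.rpow_nonneg (hc.trans hτ).le _

/-- Translation of a `lintegral` over a half-line: `∫_{(a,∞)} f(s - a) ds = ∫_{(0,∞)} f`. [folklore] -/
theorem lintegral_Ioi_comp_sub (f : ℝ → ℝ≥0∞) (a : ℝ) :
    ∫⁻ s in Ioi a, f (s - a) = ∫⁻ t in Ioi 0, f t := by
  rw [← lintegral_indicator measurableSet_Ioi, ← lintegral_indicator measurableSet_Ioi,
    ← lintegral_sub_right_eq_self (fun t => (Ioi (0 : ℝ)).indicator f t) a]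
  refine lintegral_congr fun s => ?_
  simp only [Set.indicator_apply, mem_Ioi, sub_pos]

end PowerIntegrals

end Literature.Analysis.UnboundedOperators
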